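import Summits.RiemannHypothesis.RiemannHypothesis.Theorems.Splittings.JensenX4NewmanDerivStrip

/-!
# Splittings — X-4 × NEWMAN, part 2/2: `newmanDeriv : ∀ t < 0, ¬ HasOnlyRealZeros (deriv (deBruijnH t))`
# (growth of `γ_t′/γ_t`, the differentiated Dobner Theorem 4, and the main theorem; SPLIT-jen-neg gen 4; zero-definition raw form)

Cell rh-split (brief sha16 f79c5f09d8bcb036), seat rh-split-jen-neg g4, card `run/shared/lean/pub/rh-split/cards/SPLIT-jen-neg.md`
ADDENDUM 5 (booked 03:01Z; refines the annotation of the SURVIVOR row X-4); carved from `HOME/rh-split-jen-neg/g4/SketchG4Newman.lean`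
(sha16 3c5fe06033ba3250, 630 l, zero defs, zero sorry) by rh-split-typer-2 g3 on the lead's queue 03:14Z item (1); referee rh-split-ref g2
CONTENT PRE-FILE PASS 03:07:43Z («→ Theorems/Splittings/JensenX4NewmanDeriv ×2 parts, zero-def, re-namespace»; ROUTING OF RECORD:
Theorems side — «Λ^{(1)} ≥ 0» is not stated in print, so it is not a Literature fact file even though its imports are Literature-only).
TWO-FILE split forced by the 400-line rule: part 1 = §§T1–T2 (`Splittings/JensenX4NewmanDerivStrip.lean`), part 2 = §§T3–T4 + the
main theorem (`Splittings/JensenX4NewmanDeriv.lean`); namespace `…Splittings.JensenX4NewmanDeriv` in both; declarations byte-identical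
to the seat's.

Content of this part: §T3 growth of `γ_t′/γ_t` on vertical strips (Stirling for `Re ψ`), §T4 the derivative of Dobner's Theorem 4
(Cauchy estimate on unit discs), and the MAIN THEOREM `newmanDeriv` — every backward heat-flow deformation `H_t` (`t < 0`) of
`H_0 = Ξ(·/2)/8` has a derivative with a non-real zero (the `m = 1` case «Λ^{(1)} ≥ 0» of Newman's conjecture for the derivatives);
with part 1's `newmanDeriv_of` and the dictionary `Splittings/JensenX4NewmanDict.lean` (conjunct A of X-4 ⟺ `H_0′` hyperbolic):
«A ⟺ Λ^{(1)} = 0».  Referee replay (03:07Z): std axioms; flow rows reproduced.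

HONEST LABEL: «SPLITTING SEARCH over kernel-typed RH-EQUIVALENCES; a splitting A ∧ B ⟹ RH is CONDITIONAL bookkeeping unless A and B are
both proved; nothing here bears on the truth of RH.»
-/

set_option linter.dupNamespace false

noncomputable section

open Complex Filter Set Topology Metric

namespace Summit.RiemannHypothesis.RiemannHypothesis.Theorems.Splittings.JensenX4NewmanDeriv

open Literature Literature.NumberTheory.LFunctions

/-! ## T3. Growth of `γ_t′/γ_t` on vertical strips (Stirling for `Re ψ`) -/

/-- Iterated recurrence `ψ(w + n) = ψ(w) + Σ_{j<n} (w + j)⁻¹` off the real axis. -/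
theorem digamma_add_nat {w : ℂ} (hw : w.im ≠ 0) (n : ℕ) :
    Complex.digamma (w + n) = Complex.digamma w + ∑ j ∈ Finset.range n, (w + j)⁻¹ := by
  induction n with
  | zero => simp
  | succ n ih =>
    have hne : ∀ m : ℕ, w + n ≠ -m := fun m h ↦ by
      have := congrArg Complex.im h
      simp at this
      exact hw this
    rw [Nat.cast_succ, ← add_assoc, Complex.digamma_apply_add_one _ hne, ih, Finset.sum_range_succ]
    ring

/-- `Re ψ(w) ≥ log(Im w) − 2 − n` whenever `Im w ≥ 1` and `Re w + n > 0`. -/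
theorem re_digamma_ge_log_sub {w : ℂ} (hw : 1 ≤ w.im) (n : ℕ) (hn : 0 < w.re + n) :
    Real.log w.im - 2 - n ≤ (Complex.digamma w).re := by
  have hw0 : w.im ≠ 0 := by linarith
  have h := digamma_add_nat hw0 n
  have hK := KadiriDigamma.re_digamma_ge (X := w.re + n) (Y := w.im) hn (by linarith)
  have hwn : ((w.re + n : ℝ) : ℂ) + (w.im : ℂ) * I = w + n := by
    apply Complex.ext <;> simp
  rw [hwn] at hK
  have e1 : (w.re + n) / (2 * ((w.re + n) ^ 2 + w.im ^ 2)) ≤ 1 := by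
    rw [div_le_one (by positivity)]
    nlinarith [sq_nonneg (w.re + n - 1 / 4), hw]
  have e2 : 1 / (6 * w.im ^ 3) + Real.pi / (12 * w.im ^ 2) ≤ 1 := by
    have h3 : 1 ≤ w.im ^ 3 := one_le_pow₀ hw
    have h2 : 1 ≤ w.im ^ 2 := one_le_pow₀ hw
    have a1 : 1 / (6 * w.im ^ 3) ≤ 1 / 6 := by
      apply div_le_div_of_nonneg_left (by norm_num) (by norm_num) (by linarith)
    have a2 : Real.pi / (12 * w.im ^ 2) ≤ Real.pi / 12 := by
      apply div_le_div_of_nonneg_left Real.pi_pos.le (by norm_num) (by linarith)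
    linarith [Real.pi_lt_four]
  -- the correction sum
  have hsum : (∑ j ∈ Finset.range n, (w + j)⁻¹).re ≤ n := by
    rw [Complex.re_sum]
    calc ∑ j ∈ Finset.range n, ((w + j)⁻¹).re ≤ ∑ j ∈ Finset.range n, (1 : ℝ) := by
          refine Finset.sum_le_sum fun j _ ↦ ?_
          have hnorm : 1 ≤ ‖w + j‖ := by
            have : (w + j).im = w.im := by simp
            calc (1 : ℝ) ≤ w.im := hw
              _ = |(w + j).im| := by rw [this, abs_of_pos (by linarith)]
              _ ≤ ‖w + j‖ := abs_im_le_norm _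
          calc ((w + j)⁻¹).re ≤ ‖(w + j)⁻¹‖ := (le_abs_self _).trans (abs_re_le_norm _)
            _ = ‖w + j‖⁻¹ := norm_inv _
            _ ≤ 1 := inv_le_one_of_one_le₀ hnorm
      _ = n := by simp
  have : (Complex.digamma w).re = (Complex.digamma (w + n)).re - (∑ j ∈ Finset.range n, (w + j)⁻¹).re := by
    rw [h, Complex.add_re]; ring
  rw [this]
  linarith

/-- The derivative of `γ_t` on the open upper half-plane. -/
theorem hasDerivAt_dobnerGammaT (t : ℝ) {s : ℂ} (hs : 0 < s.im) :
    HasDerivAt (dobnerGammaT t)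
      (((2 * s - 1) / 2 * Gammaℝ s + s * (s - 1) / 2 *
          (Gammaℝ s * (-(Complex.log (Real.pi : ℂ)) / 2 + Complex.digamma (s / 2) / 2))) *
        Complex.exp ((1 / |t| : ℝ) * (s - dobnerJ t s) ^ 2) +
      xiGammaFactor s * (Complex.exp ((1 / |t| : ℝ) * (s - dobnerJ t s) ^ 2) *
        ((1 / |t| : ℝ) * ((2 : ℕ) * (s - dobnerJ t s) ^ (2 - 1) * (1 - (1 + (|t| / 4 : ℝ) * s⁻¹)))))) s := by
  have hhalf : ∀ m : ℕ, s / 2 ≠ -m := half_ne_neg_nat_of_re_pos_or_im_ne_zero (Or.inr hs.ne')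
  have hΓ := RealZeros.hasDerivAt_Gammaℝ hhalf
  have hP : HasDerivAt (fun s : ℂ ↦ s * (s - 1) / 2) ((2 * s - 1) / 2) s := by
    have h1 : HasDerivAt (fun s : ℂ ↦ s * (s - 1)) (1 * (s - 1) + s * 1) s :=
      (hasDerivAt_id' s).mul ((hasDerivAt_id' s).sub_const 1)
    have h2 := h1.div_const 2
    have e : (1 * (s - 1) + s * 1) / 2 = (2 * s - 1) / 2 := by ring
    rw [e] at h2
    exact h2
  have hX : HasDerivAt xiGammaFactor ((2 * s - 1) / 2 * Gammaℝ s + s * (s - 1) / 2 *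
      (Gammaℝ s * (-(Complex.log (Real.pi : ℂ)) / 2 + Complex.digamma (s / 2) / 2))) s := by
    have : xiGammaFactor = fun s : ℂ ↦ s * (s - 1) / 2 * Gammaℝ s := rfl
    rw [this]
    exact hP.mul hΓ
  have hJ := hasDerivAt_dobnerJ t hs
  have hu : HasDerivAt (fun s : ℂ ↦ (s - dobnerJ t s) ^ 2)
      ((2 : ℕ) * (s - dobnerJ t s) ^ (2 - 1) * (1 - (1 + (|t| / 4 : ℝ) * s⁻¹))) s :=
    ((hasDerivAt_id s).sub hJ).fun_pow 2
  have hE := (hu.const_mul ((1 / |t| : ℝ) : ℂ)).cexp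
  have : dobnerGammaT t = fun s : ℂ ↦ xiGammaFactor s *
      Complex.exp ((1 / |t| : ℝ) * (s - dobnerJ t s) ^ 2) := rfl
  rw [this]
  exact hX.mul hE

/-- `‖Log(s/2π)‖ ≤ ‖s‖` once `‖s‖ ≥ 8`. -/
theorem norm_log_div_two_pi_le {s : ℂ} (hs : 8 ≤ ‖s‖) :
    ‖Complex.log (s / (2 * Real.pi))‖ ≤ ‖s‖ := by
  have hpi := Real.pi_lt_four
  have hpi3 := Real.pi_gt_three
  have hn : ‖s / (2 * Real.pi)‖ = ‖s‖ / (2 * Real.pi) := by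
    rw [norm_div]
    congr 1
    rw [show (2 * (Real.pi : ℂ)) = ((2 * Real.pi : ℝ) : ℂ) by push_cast; rfl, Complex.norm_real,
      Real.norm_eq_abs, abs_of_pos (by positivity)]
  have h1 : 1 ≤ ‖s‖ / (2 * Real.pi) := by
    rw [le_div_iff₀ (by positivity)]; linarith
  have hre : |(Complex.log (s / (2 * Real.pi))).re| ≤ ‖s‖ / (2 * Real.pi) := by
    rw [Complex.log_re, hn, abs_of_nonneg (Real.log_nonneg h1)]
    linarith [Real.log_le_sub_one_of_pos (by positivity : 0 < ‖s‖ / (2 * Real.pi))]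
  have him : |(Complex.log (s / (2 * Real.pi))).im| ≤ Real.pi := by
    rw [Complex.log_im]; exact Complex.abs_arg_le_pi _
  have hdiv : ‖s‖ / (2 * Real.pi) ≤ ‖s‖ / 6 := by
    apply div_le_div_of_nonneg_left (norm_nonneg _) (by norm_num) (by linarith)
  calc ‖Complex.log (s / (2 * Real.pi))‖
      ≤ |(Complex.log (s / (2 * Real.pi))).re| + |(Complex.log (s / (2 * Real.pi))).im| :=
        Complex.norm_le_abs_re_add_abs_im _
    _ ≤ ‖s‖ / 6 + Real.pi := by linarith
    _ ≤ ‖s‖ := by linarith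

/-- **Growth**: on every vertical strip, `‖γ_t′(s)‖ ≥ K ‖γ_t(s)‖` for `Im s` large. -/
theorem dobnerGammaT_deriv_growth {t : ℝ} (ht : t < 0) (a b : ℝ) (_hab : a ≤ b) (K : ℝ) :
    ∃ y₁ : ℝ, 0 < y₁ ∧ ∀ s : ℂ, a ≤ s.re → s.re ≤ b → y₁ ≤ s.im →
      K * ‖dobnerGammaT t s‖ ≤ ‖deriv (dobnerGammaT t) s‖ := by
  have ht' : 0 < |t| := abs_pos.2 ht.ne
  set n : ℕ := ⌈|a|⌉₊ + 1 with hn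
  set y₁ : ℝ := max 8 (2 * Real.exp (2 * |K| + n + |t| + 8)) with hy₁
  refine ⟨y₁, lt_of_lt_of_le (by norm_num) (le_max_left _ _), fun s hsa hsb hsy ↦ ?_⟩
  have hs8 : 8 ≤ s.im := (le_max_left _ _).trans hsy
  have hs_im : 0 < s.im := by linarith
  have hsnorm : s.im ≤ ‖s‖ := (le_abs_self _).trans (abs_im_le_norm s)
  have hs0 : s ≠ 0 := fun h ↦ by simp [h] at hs_im
  have hs1 : s - 1 ≠ 0 := fun h ↦ by
    have := congrArg Complex.im h; simp at this; linarith
  -- names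
  set M₁ : ℂ := -(Complex.log (Real.pi : ℂ)) / 2 + Complex.digamma (s / 2) / 2 with hM₁
  set u' : ℂ := ((1 / |t| : ℝ) : ℂ) * ((2 : ℕ) * (s - dobnerJ t s) ^ (2 - 1) *
    (1 - (1 + (|t| / 4 : ℝ) * s⁻¹))) with hu'
  set E : ℂ := Complex.exp ((1 / |t| : ℝ) * (s - dobnerJ t s) ^ 2) with hE
  have hderiv : deriv (dobnerGammaT t) s =
      Gammaℝ s * E * ((2 * s - 1) / 2 + s * (s - 1) / 2 * (M₁ + u')) := by
    rw [(hasDerivAt_dobnerGammaT t hs_im).deriv, xiGammaFactor]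
    ring
  have hγ : dobnerGammaT t s = Gammaℝ s * E * (s * (s - 1) / 2) := by
    rw [dobnerGammaT, xiGammaFactor]; ring
  -- (1) `Re M₁ ≥ |K| + |t|/2 + 2`
  have hψ : Real.log (s.im / 2) - 2 - n ≤ (Complex.digamma (s / 2)).re := by
    have h := re_digamma_ge_log_sub (w := s / 2) (by rw [Complex.div_ofNat_im]; linarith) n
      (by
        rw [Complex.div_ofNat_re]
        have : |a| ≤ ⌈|a|⌉₊ := Nat.le_ceil _
        have hn' : (n : ℝ) = ⌈|a|⌉₊ + 1 := by rw [hn]; push_cast; ring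
        rw [hn']
        linarith [neg_abs_le a, hsa.trans (le_refl s.re)])
    rwa [Complex.div_ofNat_im] at h
  have hlogπ : Real.log Real.pi < 2 := by
    rw [Real.log_lt_iff_lt_exp Real.pi_pos]
    have h1 := Real.exp_one_gt_d9
    have : Real.exp 2 = Real.exp 1 * Real.exp 1 := by rw [← Real.exp_add]; norm_num
    nlinarith [Real.pi_lt_four]
  have hlogy : 2 * |K| + n + |t| + 8 ≤ Real.log (s.im / 2) := by
    rw [Real.le_log_iff_exp_le (by linarith)]
    linarith [(le_max_right _ _).trans hsy]
  have hM₁re : |K| + |t| / 2 + 2 ≤ M₁.re := by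
    have : M₁.re = -(Real.log Real.pi) / 2 + (Complex.digamma (s / 2)).re / 2 := by
      rw [hM₁, Complex.add_re, Complex.div_ofNat_re, Complex.div_ofNat_re, Complex.neg_re,
        Complex.log_re, Complex.norm_real, Real.norm_eq_abs, abs_of_pos Real.pi_pos]
    rw [this]
    linarith
  -- (2) `‖u'‖ ≤ |t|/8`
  have hu'norm : ‖u'‖ ≤ |t| / 8 := by
    have hsub : s - dobnerJ t s = -(((|t| / 4 : ℝ) : ℂ) * Complex.log (s / (2 * Real.pi))) := by
      rw [dobnerJ]; ring
    have hone : (1 - (1 + ((|t| / 4 : ℝ) : ℂ) * s⁻¹) : ℂ) = -(((|t| / 4 : ℝ) : ℂ) * s⁻¹) := by ring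
    have hL := norm_log_div_two_pi_le (s := s) (by linarith)
    rw [hu', hone, pow_one, hsub]
    simp only [norm_mul, norm_neg, Complex.norm_real, Complex.norm_natCast, norm_inv,
      Real.norm_eq_abs, abs_of_pos (by positivity : (0:ℝ) < |t| / 4),
      abs_of_pos (by positivity : (0:ℝ) < 1 / |t|)]
    have hspos : 0 < ‖s‖ := by linarith
    calc 1 / |t| * (2 * (|t| / 4 * ‖Complex.log (s / (2 * Real.pi))‖) * (|t| / 4 * ‖s‖⁻¹))
        = |t| / 8 * (‖Complex.log (s / (2 * Real.pi))‖ * ‖s‖⁻¹) := by field_simp; ring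
      _ ≤ |t| / 8 * 1 := by
          gcongr
          rw [← div_eq_mul_inv, div_le_one hspos]
          exact hL
      _ = |t| / 8 := mul_one _
  -- (3) `‖M₁ + u'‖ ≥ |K| + 2` and `‖(2s−1)/2‖ ≤ ‖s(s−1)/2‖`
  have hMu : |K| + 2 ≤ ‖M₁ + u'‖ := by
    have h1 : (M₁ + u').re ≤ ‖M₁ + u'‖ := (le_abs_self _).trans (abs_re_le_norm _)
    have h2 : -‖u'‖ ≤ u'.re := (neg_le.1 ((neg_le_abs _).trans (abs_re_le_norm _)))
    rw [Complex.add_re] at h1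
    linarith [abs_nonneg t]
  have hlin : ‖(2 * s - 1) / 2‖ ≤ ‖s * (s - 1) / 2‖ := by
    rw [norm_div, norm_div, norm_mul]
    gcongr
    have hn1 : s.im ≤ ‖s - 1‖ := by
      have : (s - 1).im = s.im := by simp
      calc s.im = |(s - 1).im| := by rw [this, abs_of_pos hs_im]
        _ ≤ ‖s - 1‖ := abs_im_le_norm _
    calc ‖2 * s - 1‖ = ‖s + (s - 1)‖ := by ring_nf
      _ ≤ ‖s‖ + ‖s - 1‖ := norm_add_le _ _
      _ ≤ ‖s‖ * ‖s - 1‖ := by nlinarith [norm_nonneg s, norm_nonneg (s - 1)]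
  -- assemble
  rw [hderiv, hγ, norm_mul, norm_mul (Gammaℝ s * E)]
  have hGE : 0 ≤ ‖Gammaℝ s * E‖ := norm_nonneg _
  have hP0 : 0 ≤ ‖s * (s - 1) / 2‖ := norm_nonneg _
  have key : K * ‖s * (s - 1) / 2‖ ≤ ‖(2 * s - 1) / 2 + s * (s - 1) / 2 * (M₁ + u')‖ := by
    have hrev : ‖s * (s - 1) / 2 * (M₁ + u')‖ - ‖(2 * s - 1) / 2‖ ≤
        ‖(2 * s - 1) / 2 + s * (s - 1) / 2 * (M₁ + u')‖ := by
      have h := norm_sub_le ((2 * s - 1) / 2 + s * (s - 1) / 2 * (M₁ + u')) ((2 * s - 1) / 2)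
      rw [add_sub_cancel_left] at h
      linarith
    rw [norm_mul] at hrev
    have hK : K ≤ |K| := le_abs_self K
    nlinarith [hMu, hlin, hP0, hK, abs_nonneg K]
  calc K * (‖Gammaℝ s * E‖ * ‖s * (s - 1) / 2‖) = ‖Gammaℝ s * E‖ * (K * ‖s * (s - 1) / 2‖) := by ring
    _ ≤ ‖Gammaℝ s * E‖ * ‖(2 * s - 1) / 2 + s * (s - 1) / 2 * (M₁ + u')‖ := by gcongr

/-! ## T4. The derivative of Dobner's Theorem 4 (Cauchy estimate on unit discs) -/

/-- From `ξ_t(J_t s) = γ_t(s)(ζ_t(s) + E(s))` with `‖E‖ ≤ ε` on strips (Dobner Thm. 4, tree fact)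
one gets `(ξ_t ∘ J_t)′(s) = γ_t′(s) (ζ_t(s) + o(1))`, uniformly on strips, as `Im s → ∞`. -/
theorem xiDeformed_deriv_approx {t : ℝ} (ht : t < 0) (a b : ℝ) (hab : a ≤ b) (ε : ℝ) (hε : 0 < ε) :
    ∃ y₀ : ℝ, ∀ s : ℂ, a ≤ s.re → s.re ≤ b → y₀ ≤ s.im →
      ‖deriv (fun s ↦ xiDeformed t (dobnerJ t s)) s - deriv (dobnerGammaT t) s * zetaDeformed t s‖
        ≤ ε * ‖deriv (dobnerGammaT t) s‖ := by
  set F : ℂ → ℂ := fun s ↦ xiDeformed t (dobnerJ t s) with hF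
  set Q : ℂ → ℂ := fun s ↦ F s / dobnerGammaT t s with hQ
  obtain ⟨Z, hZ⟩ := exists_norm_zetaDeformed_le_of_le_re ht (a - 1)
  have hZ0 : 0 ≤ Z := (norm_nonneg _).trans (hZ (a : ℂ) (by simp))
  obtain ⟨y, hy⟩ := dobner_xiDeformed_approx_holds t ht (a - 1) (b + 1) (by linarith) (ε / 2)
    (by linarith)
  set K : ℝ := 2 * (Z + ε / 2) / ε + 1 with hK
  have hKpos : 0 < K := by positivity
  obtain ⟨y₁, hy₁, hgr⟩ := dobnerGammaT_deriv_growth ht a b hab K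
  refine ⟨max (y + 1) (max y₁ 2), fun s hsa hsb hsy ↦ ?_⟩
  have hs_y : y + 1 ≤ s.im := (le_max_left _ _).trans hsy
  have hs_y₁ : y₁ ≤ s.im := ((le_max_left _ _).trans (le_max_right _ _)).trans hsy
  have hs2 : 2 ≤ s.im := ((le_max_right _ _).trans (le_max_right _ _)).trans hsy
  have hs_im : 0 < s.im := by linarith
  -- points of the closed unit disc around `s` lie in the wide strip, high up
  have hdisc : ∀ z ∈ Metric.closedBall s 1,
      a - 1 ≤ z.re ∧ z.re ≤ b + 1 ∧ y ≤ z.im ∧ 0 < z.im := by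
    intro z hz
    obtain ⟨h1, h2⟩ := abs_re_im_sub_le_of_mem_closedBall hz
    have h1' := abs_le.1 h1
    have h2' := abs_le.1 h2
    refine ⟨by linarith, by linarith, by linarith, by linarith⟩
  -- `E := Q − ζ_t` is small on the disc
  have hE : ∀ z ∈ Metric.closedBall s 1, ‖Q z - zetaDeformed t z‖ ≤ ε / 2 := by
    intro z hz
    obtain ⟨h1, h2, h3, h4⟩ := hdisc z hz
    have hγ0 : dobnerGammaT t z ≠ 0 := dobnerGammaT_ne_zero t h4.ne'
    have h := hy z h1 h2 h3
    have : Q z - zetaDeformed t z =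
        (F z - dobnerGammaT t z * zetaDeformed t z) / dobnerGammaT t z := by
      rw [hQ]
      field_simp
    rw [this, norm_div, div_le_iff₀ (norm_pos_iff.2 hγ0)]
    exact h
  -- `Q` is holomorphic on the upper half-plane
  have hQdiff : ∀ z : ℂ, 0 < z.im → DifferentiableAt ℂ Q z := fun z hz ↦
    (((differentiable_xiDeformed t).differentiableAt).comp z (differentiableAt_dobnerJ t hz)).div
      (differentiableAt_dobnerGammaT t hz) (dobnerGammaT_ne_zero t hz.ne')
  -- Cauchy estimate
  have hQ' : ‖deriv Q s‖ ≤ Z + ε / 2 := by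
    have hd : DiffContOnCl ℂ Q (Metric.ball s 1) := by
      apply DifferentiableOn.diffContOnCl
      rw [closure_ball s one_ne_zero]
      intro z hz
      exact (hQdiff z (hdisc z hz).2.2.2).differentiableWithinAt
    have hC : ∀ z ∈ Metric.sphere s 1, ‖Q z‖ ≤ Z + ε / 2 := by
      intro z hz
      have hz' : z ∈ Metric.closedBall s 1 := Metric.sphere_subset_closedBall hz
      have h1 := hE z hz'
      have h2 := hZ z (hdisc z hz').1
      calc ‖Q z‖ = ‖zetaDeformed t z + (Q z - zetaDeformed t z)‖ := by ring_nf
        _ ≤ ‖zetaDeformed t z‖ + ‖Q z - zetaDeformed t z‖ := norm_add_le _ _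
        _ ≤ Z + ε / 2 := add_le_add h2 h1
    have := Complex.norm_deriv_le_of_forall_mem_sphere_norm_le one_pos hd hC
    simpa using this
  -- product rule: `F = γ_t · Q` near `s`
  have hγd : HasDerivAt (dobnerGammaT t) (deriv (dobnerGammaT t) s) s :=
    (differentiableAt_dobnerGammaT t hs_im).hasDerivAt
  have hQd : HasDerivAt Q (deriv Q s) s := (hQdiff s hs_im).hasDerivAt
  have hFQ : F =ᶠ[nhds s] fun z ↦ dobnerGammaT t z * Q z := by
    have hopen : IsOpen {z : ℂ | 0 < z.im} := isOpen_lt continuous_const Complex.continuous_im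
    filter_upwards [hopen.mem_nhds hs_im] with z hz
    have hγ0 : dobnerGammaT t z ≠ 0 := dobnerGammaT_ne_zero t (ne_of_gt hz)
    rw [hQ]
    simp only
    field_simp
  have hFd : deriv F s = deriv (dobnerGammaT t) s * Q s + dobnerGammaT t s * deriv Q s := by
    rw [hFQ.deriv_eq]
    exact (hγd.mul hQd).deriv
  have hEs := hE s (Metric.mem_closedBall_self zero_le_one)
  have hgrs := hgr s hsa hsb hs_y₁
  have hcalc : deriv F s - deriv (dobnerGammaT t) s * zetaDeformed t s =
      deriv (dobnerGammaT t) s * (Q s - zetaDeformed t s) + dobnerGammaT t s * deriv Q s := by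
    rw [hFd]; ring
  show ‖deriv F s - deriv (dobnerGammaT t) s * zetaDeformed t s‖ ≤ ε * ‖deriv (dobnerGammaT t) s‖
  rw [hcalc]
  have hγle : ‖dobnerGammaT t s‖ ≤ ‖deriv (dobnerGammaT t) s‖ / K := by
    rw [le_div_iff₀ hKpos, mul_comm]; exact hgrs
  have hfrac : (Z + ε / 2) / K ≤ ε / 2 := by
    rw [div_le_iff₀ hKpos, hK]
    have : ε / 2 * (2 * (Z + ε / 2) / ε + 1) = (Z + ε / 2) + ε / 2 := by
      field_simp
    rw [this]
    linarith
  have h0 : 0 ≤ ‖deriv (dobnerGammaT t) s‖ := norm_nonneg _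
  calc ‖deriv (dobnerGammaT t) s * (Q s - zetaDeformed t s) + dobnerGammaT t s * deriv Q s‖
      ≤ ‖deriv (dobnerGammaT t) s‖ * ‖Q s - zetaDeformed t s‖ + ‖dobnerGammaT t s‖ * ‖deriv Q s‖ := by
        refine (norm_add_le _ _).trans ?_
        rw [norm_mul, norm_mul]
    _ ≤ ‖deriv (dobnerGammaT t) s‖ * (ε / 2) + ‖deriv (dobnerGammaT t) s‖ / K * (Z + ε / 2) := by
        gcongr
    _ = ‖deriv (dobnerGammaT t) s‖ * (ε / 2 + (Z + ε / 2) / K) := by ring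
    _ ≤ ‖deriv (dobnerGammaT t) s‖ * (ε / 2 + ε / 2) := by gcongr
    _ = ε * ‖deriv (dobnerGammaT t) s‖ := by ring

/-! ## Main theorem -/

/-- **Newman's conjecture for `Ξ′` (kernel form).** For every `t < 0` the derivative `H_t′` of the
de Bruijn–Newman deformation has a non-real zero; equivalently `Λ^{(1)} ≥ 0` for the de
Bruijn–Newman constant of `Ξ′`.  Inputs: Dobner's Theorem 4 (`dobner_xiDeformed_approx_holds`),
Lemma 3 (`dobner_zetaDeformed_exists_zero_holds`), Bohr almost periodicity
(`bohr_almost_periodic_holds`) — all proved tree facts — plus Hurwitz, a Cauchy estimate and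
Stirling-type growth of `γ_t′/γ_t`. -/
theorem newmanDeriv (t : ℝ) (ht : t < 0) : ¬ HasOnlyRealZeros (deriv (deBruijnH t)) :=
  newmanDeriv_of ht (fun a b hab K ↦ dobnerGammaT_deriv_growth ht a b hab K)
    (fun a b hab ε hε ↦ xiDeformed_deriv_approx ht a b hab ε hε)

end Summit.RiemannHypothesis.RiemannHypothesis.Theorems.Splittings.JensenX4NewmanDeriv

end
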